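import Summits.HodgeConjecture.HodgeConjecture.Theorems.F0P6aCanonicalTwistIdealAsReflexTypeNorm   -- ★ p849648 (LA4-p04 (g2)): §2 `prod_filter_ker_eq_idealReflexTypeNorm` (embedding product = `g_F(𝔭_w)`)
import Summits.HodgeConjecture.HodgeConjecture.Theorems.F0P6aKottwitzCountAtSplitPlace              -- ★ p847313: `ker_residue_restrict_structural(_comp_complexConj)` (`τ_w ↦ w`, `τ_w ∘ c ↦ c•w`)
import Literature.NumberTheory.ComplexMultiplication.InducedCMType                                  -- ★ `valuedIn ι Ψ = {σ | ι ∘ σ ∈ Ψ}` (a type read in `Hom(F, F)` through `ι₁`)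
import Literature.NumberTheory.ComplexMultiplication.CMTypeBasic                                     -- ★ `CMTypeOps.flip`, `CMTypeOps.bar`, `mem_flip_iff`, `mem_bar_iff`, `placeSet`
import HarnessLib

/-!
# Crux `HLiu418` — P6 sub-line **F0-P6a**, (S8) `stub_ESHEET` ∕ organ (S6)⊕(S7) «TWIST DATA»: **(S7-F) THE FROBENIUS PIN READ ON `F`** —
# the reflex type norm of `𝔭_w` for the chart՚s TWIST TYPE `Φ_tw = flip ι₁ (bar Φ)`, read in `Hom(F, F)` through `ι₁`, IS the canonical twist ideal `𝔞_can(m₁, τR₁, w)`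

Cell `hodgecm-mathlib` (D-0151), crux `stmt-HodgeConjecture-24832` (hLiu418), `--supports … --as helper` (count-neutral).  «L4» DEAL #30 (`stub_TWIST`, lead
LA4-p05 (g4)): the assembly `F0/P6/L4/LA4-p05/g4/StubESHEET.stubTWIST.paid-modulo-S7F.v1.LA4-p05g4.lean` (ce952d9d) pays the socket MODULO ONE named input
`s7F_pin` (:187) — the identity, in `F`-currency and with NO reflex compositum `E♯`,
`idealReflexTypeNorm (valuedIn ι₁ (twistType ι₁ Φ hΦ).1) (RingHom.id F) (RingHom.id F) 𝔭_w = ∏ τ ∈ univ.filter (mOf ι₁ Φ (σ₁ ∘ τ) ≠ 0 ∧ τ ∤ c•w), ker (residue ∘ τR₁ τ)`,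
consumed by p850297 `F0P6aSheetTwistFrobenius.exists_sheetTwist_frobenius … (hcan := s7F_pin …)`.  THIS FILE proves it, THEOREMS ONLY and with NO `Cruxes/…/Lines`
import: the Lines tokens are read BY VALUE — `twistType ι₁ Φ hΦ` is `flip ι₁ (bar ⟨Φ, hΦ.2⟩)` (`rfl`), the Kottwitz signature `mOf ι₁ Φ` is an abstract `M` with the ONE
hypothesis `hM : ∀ φ, M φ ≠ 0 ↔ φ = ι₁ ∨ φ = ῑ₁ ∨ φ ∉ Φ` (its shape: `1` on the pair `{ι₁, ῑ₁}`, `0` on `Φ` off the pair, `2` on `Φᶜ` off the pair; `simp [mOf]` at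
the call site), and `KottAdaptedAt ι₁ w Φ` is taken as its `def` body VERBATIM (`hΦw`, §3), so that `s7F_pin` is ONE application (§3, `…_of_kottAdaptedAt`).

THE TWO LINKS.  (1) ★ p849648 §2 `prod_filter_ker_eq_idealReflexTypeNorm` at the admissible presentation `(Lg, ι, j, σ₀) := (F, ι₁, id, id)` (compatible with any
`σ₁ : F̄_w → ℂ` over `ι₁`) says `∏_{τ : σ₁ ∘ τ ∈ Ψ} ker (residue ∘ τR₁ τ) = g_F(𝔭_w)` for the type `{φ : F → F | ι₁ ∘ φ ∈ Ψ}` — which IS ★ `valuedIn ι₁ Ψ`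
(`Iff.rfl`), for ANY `Ψ ⊆ Hom(F, ℂ)` (§2).  (2) The INDEX-SET IDENTITY (§1, the Lines-free re-typing of LA4-p04 (g2)՚s snippet #3 `filter_canType_eq_filter_twistType`):
at a split place (`c•w ≠ w`), for `σ₁` over `ι₁` and a frame `Φ ∋ ι₁` ADAPTED to `w` at `(τR₁, σ₁)` («every `τ ↦ c•w` other than `τ_w ∘ c` has `σ₁ ∘ τ ∈ Φ`»),
`(M (σ₁ ∘ τ) ≠ 0 ∧ τ ∤ c•w) ↔ σ₁ ∘ τ ∈ Φ_tw` where `Φ_tw = flip ι₁ (bar Φ) = {ι₁} ∪ (Φᶜ ∖ {ῑ₁}) = {φ | M φ ≠ 0 ∧ φ ≠ ῑ₁}` (§0): on the `c•w`-block the only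
embedding with `M ≠ 0` is `τ_w ∘ c`, the `p`-adic partner of `ῑ₁` (`σ₁ ∘ τ_w ∘ c = ῑ₁`, Mathlib `IsCMField.complexEmbedding_complexConj`; ★ p847313
`ker_residue_restrict_structural_comp_complexConj`), every other one lying in `Φ` off the pair; and `τ_w ↦ w ≠ c•w` (★ `ker_residue_restrict_structural`).
Adaptedness at `(τR₁, σ₁)` is ALSO a consequence of the Kottwitz COUNT `∑_{τ ↦ c•w} M (σ₁ ∘ τ) = 1` (§1 `comp_mem_of_sum_eq_one`, LA4-p05 (g4) 07:46:38Z), so the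
head is offered from either provenance (§3).  `UnmixedAt` is not needed.

MAIN STATEMENTS.  §0 `mem_flip_bar_iff` (`φ ∈ flip ι₁ (bar Φ) ↔ φ = ι₁ ∨ (φ ∉ Φ ∧ φ ≠ ῑ₁)`), `mem_flip_bar_iff_of_signature`; §1 `signature_ne_zero_and_ker_ne_iff`
(pointwise), `filter_signature_eq_filter_comp_mem_flip_bar` (index sets), `comp_mem_of_sum_eq_one` (adaptedness from the count); §2
**`prod_filter_ker_eq_idealReflexTypeNorm_valuedIn`**; §3 HEADS **`idealReflexTypeNorm_valuedIn_flip_bar_eq_prod_filter`** (adapted at `(τR₁, σ₁)`),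
`…_of_sum_eq_one` (from the count), **`…_of_kottAdaptedAt`** (hypothesis = the body of `KottAdaptedAt ι₁ w Φ` verbatim, `hσ₁` in its tower form — the `s7F_pin` shape).
HONEST LABEL.  HC_CM is proved only modulo the 7 printed citations (2 remaining named inputs: hLiu418 = stmt-HodgeConjecture-24832, h413 = stmt-HodgeConjecture-24833)
until rung 0 closes; nothing here changes a count.
[cite: Shimura1998, §13.1 (1), (7) and Theorem 1 (pp. 97–99); §18.6 proof pp. 127–128] [cite: MilneCM2006, Ch. I §1 Prop. 1.26 (11), Rem. 1.25]
[cite: RapoportSmithlingZhang2020Diagonal, §3.2 (3.8) p. 11; §4.1 (4.6) p. 16 and p. 17; Remark 3.6 (i) (3.14) p. 13] [cite: Kottwitz1992, §5 pp. 389–391]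
-/

set_option autoImplicit false
set_option linter.dupNamespace false  -- `Summit.HodgeConjecture.HodgeConjecture.…` BY DESIGN (D-0017)

noncomputable section

open NumberField IsDedekindDomain IsLocalRing
open scoped Pointwise
open Literature.NumberTheory.GaloisRepresentations (closureValuationSubring)
open Literature.NumberTheory.Automorphic
open Literature.NumberTheory.ComplexMultiplication
open Literature.NumberTheory.ComplexMultiplication.CMTypeOps (flip bar placeSet mem_flip_iff mem_bar_iff mem_iff_conjugate_notMem)
open Literature.AlgebraicGeometry.Motives (CMType)
open Summit.HodgeConjecture.HodgeConjecture.Theorems.F0P6aKottwitzCountAtSplitPlace (ker_residue_restrict_structural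
  ker_residue_restrict_structural_comp_complexConj)
open Summit.HodgeConjecture.HodgeConjecture.Theorems.F0P6aCanonicalTwistIdealAsReflexTypeNorm (prod_filter_ker_eq_idealReflexTypeNorm)

namespace Summit.HodgeConjecture.HodgeConjecture.Theorems.F0P6aTwistTypeFrobeniusPin

variable {F : Type} [Field F]

/-! ### §0 The twist type `flip ι₁ (bar Φ) = {ι₁} ∪ (Φᶜ ∖ {ῑ₁})`, as a set and in the language of the Kottwitz signature -/

/-- **`flip ι₁ (bar Φ) = {ι₁} ∪ (Φᶜ ∖ {ῑ₁})`** for a CM type `Φ ∋ ι₁`: the conjugate type `Φ̄ = Φᶜ` with its member `ῑ₁` at the place of `ι₁` replaced by `ι₁`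
(RSZ՚s special pair: `Φ_tw` and `Φ̄` differ exactly at the place of `φ₀ = ι₁`). [cite: RapoportSmithlingZhang2020Diagonal, §3.2 (3.8) p. 11] [cite: MilneCM2006, Ch. I §1 Rem. 1.25] -/
theorem mem_flip_bar_iff (Φ : CMType F) {ι₁ : F →+* ℂ} (hι₁ : ι₁ ∈ Φ.1) (φ : F →+* ℂ) :
    φ ∈ (flip ι₁ (bar Φ)).1 ↔ φ = ι₁ ∨ (φ ∉ Φ.1 ∧ φ ≠ ComplexEmbedding.conjugate ι₁) := by
  have hc : ComplexEmbedding.conjugate ι₁ ∉ Φ.1 := (mem_iff_conjugate_notMem Φ ι₁).mp hι₁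
  simp only [mem_flip_iff, mem_bar_iff, placeSet, Set.mem_insert_iff, Set.mem_singleton_iff, not_or, not_not]
  constructor
  · rintro (⟨hnΦ, -, hnec⟩ | ⟨rfl | rfl, hΦ⟩)
    · exact Or.inr ⟨hnΦ, hnec⟩
    · exact Or.inl rfl
    · exact absurd hΦ hc
  · rintro (rfl | ⟨hnΦ, hnec⟩)
    · exact Or.inr ⟨Or.inl rfl, hι₁⟩
    · exact Or.inl ⟨hnΦ, fun h => hnΦ (by rw [h]; exact hι₁), hnec⟩

/-- **The twist type in the language of the Kottwitz signature**: for a signature `M` of the frame `Φ ∋ ι₁` — nonzero exactly on the pair `{ι₁, ῑ₁}` and off `Φ`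
(`hM`, the shape of the Lines token `mOf ι₁ Φ`: `1` on the pair, `0` on `Φ` off the pair, `2` on `Φᶜ` off the pair) — `φ ∈ flip ι₁ (bar Φ) ↔ M φ ≠ 0 ∧ φ ≠ ῑ₁`.
[cite: RapoportSmithlingZhang2020Diagonal, §3.2 (3.8) p. 11; Remark 3.6 (i) (3.14) p. 13] [cite: Kottwitz1992, §5 p. 390] -/
theorem mem_flip_bar_iff_of_signature (Φ : CMType F) {ι₁ : F →+* ℂ} (hι₁ : ι₁ ∈ Φ.1) (M : (F →+* ℂ) → ℕ)
    (hM : ∀ φ : F →+* ℂ, M φ ≠ 0 ↔ φ = ι₁ ∨ φ = ComplexEmbedding.conjugate ι₁ ∨ φ ∉ Φ.1) (φ : F →+* ℂ) :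
    φ ∈ (flip ι₁ (bar Φ)).1 ↔ M φ ≠ 0 ∧ φ ≠ ComplexEmbedding.conjugate ι₁ := by
  have hc : ComplexEmbedding.conjugate ι₁ ∉ Φ.1 := (mem_iff_conjugate_notMem Φ ι₁).mp hι₁
  rw [mem_flip_bar_iff Φ hι₁, hM]
  constructor
  · rintro (rfl | ⟨hnΦ, hnec⟩)
    · exact ⟨Or.inl rfl, fun h => hc (by rw [← h]; exact hι₁)⟩
    · exact ⟨Or.inr (Or.inr hnΦ), hnec⟩
  · rintro ⟨h | h | h, hnec⟩
    · exact Or.inl h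
    · exact absurd h hnec
    · exact Or.inr ⟨h, hnec⟩

/-! ### §1 The `p`-adic reading at a split place: the index-set identity -/

section Place

variable [NumberField F] [IsCMField F] (w : HeightOneSpectrum (𝓞 F))
  (τR₁ : (F →+* AlgebraicClosure (w.adicCompletion F)) → (𝓞 F →+* ↥(closureValuationSubring (w.adicCompletion F))))
  (hτR₁ : ∀ (τ : F →+* AlgebraicClosure (w.adicCompletion F)) (x : 𝓞 F),
    ((τR₁ τ x : ↥(closureValuationSubring (w.adicCompletion F))) : AlgebraicClosure (w.adicCompletion F)) = τ (x : F))
  (ι₁ : F →+* ℂ) (σ₁ : AlgebraicClosure (w.adicCompletion F) →+* ℂ)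
  (hσ₁ : σ₁.comp ((algebraMap (w.adicCompletion F) (AlgebraicClosure (w.adicCompletion F))).comp (algebraMap F (w.adicCompletion F))) = ι₁)

include hσ₁ in
/-- **The `p`-adic partner of `ῑ₁` is `τ_w ∘ c`**: `σ₁ ∘ (τ_w ∘ c) = ῑ₁` for `σ₁` over `ι₁` (Mathlib `IsCMField.complexEmbedding_complexConj`).
[cite: RapoportSmithlingZhang2020Diagonal, §3.1 p. 8; §4.1 (4.7)–(4.8) p. 16] -/
theorem comp_structural_comp_complexConj_eq :
    σ₁.comp ((((algebraMap (w.adicCompletion F) (AlgebraicClosure (w.adicCompletion F))).comp (algebraMap F (w.adicCompletion F)))).comp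
        ((IsCMField.complexConj F : F ≃ₐ[↥(maximalRealSubfield F)] F) : F →+* F)) = ComplexEmbedding.conjugate ι₁ := by
  ext x
  rw [ComplexEmbedding.conjugate_coe_eq, ← hσ₁]
  change (σ₁.comp ((algebraMap (w.adicCompletion F) (AlgebraicClosure (w.adicCompletion F))).comp (algebraMap F (w.adicCompletion F))))
      (IsCMField.complexConj F x) = _
  rw [IsCMField.complexEmbedding_complexConj]

omit [IsCMField F] in
/-- `σ₁ ∘ ·` is injective on `Hom(F, F̄_w)`: an embedding with complex partner `σ₁ ∘ τ₀` IS `τ₀`. [cite: RapoportSmithlingZhang2020Diagonal, §3.1 p. 8] -/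
theorem eq_of_comp_eq_comp {τ τ₀ : F →+* AlgebraicClosure (w.adicCompletion F)} (h : σ₁.comp τ = σ₁.comp τ₀) : τ = τ₀ :=
  RingHom.ext fun x => σ₁.injective (RingHom.congr_fun h x)

include hτR₁ hσ₁ in
/-- **THE INDEX-SET IDENTITY, POINTWISE**: at a split place `w` (`c•w ≠ w`), for `σ₁` over `ι₁`, a frame `Φ ∋ ι₁` ADAPTED to `w` at `(τR₁, σ₁)` (`hadapt`: every
`τ ↦ c•w` other than `τ_w ∘ c` has `σ₁ ∘ τ ∈ Φ`) and a signature `M` of shape `hM`:  `(M (σ₁ ∘ τ) ≠ 0 ∧ τ ∤ c•w) ↔ σ₁ ∘ τ ∈ flip ι₁ (bar Φ)`.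
(→) `τ ∤ c•w` forbids `σ₁ ∘ τ = ῑ₁` (that partner is `τ_w ∘ c ↦ c•w`).  (←) if `τ ↦ c•w` with `σ₁ ∘ τ ≠ ῑ₁` then `τ ≠ τ_w ∘ c`, adaptedness puts `σ₁ ∘ τ` in `Φ`,
and `σ₁ ∘ τ ≠ ι₁` (`τ_w ↦ w ≠ c•w`) — so `M (σ₁ ∘ τ) = 0`.
[cite: RapoportSmithlingZhang2020Diagonal, §4.1 (4.6) p. 16 and p. 17; §3.2 (3.8) p. 11] [cite: Shimura1998, §13.1 Theorem 1 (pp. 97–99) and (7)] -/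
theorem signature_ne_zero_and_ker_ne_iff (hw : (IsCMField.complexConj F) • w ≠ w) (Φ : CMType F) (hι₁ : ι₁ ∈ Φ.1)
    (M : (F →+* ℂ) → ℕ) (hM : ∀ φ : F →+* ℂ, M φ ≠ 0 ↔ φ = ι₁ ∨ φ = ComplexEmbedding.conjugate ι₁ ∨ φ ∉ Φ.1)
    (hadapt : ∀ τ : F →+* AlgebraicClosure (w.adicCompletion F),
      RingHom.ker ((residue ↥(closureValuationSubring (w.adicCompletion F))).comp (τR₁ τ)) =
        ((IsCMField.complexConj F) • w).asIdeal →
      τ ≠ ((algebraMap (w.adicCompletion F) (AlgebraicClosure (w.adicCompletion F))).comp (algebraMap F (w.adicCompletion F))).comp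
        ((IsCMField.complexConj F : F ≃ₐ[↥(maximalRealSubfield F)] F) : F →+* F) →
      σ₁.comp τ ∈ Φ.1)
    (τ : F →+* AlgebraicClosure (w.adicCompletion F)) :
    (M (σ₁.comp τ) ≠ 0 ∧
        RingHom.ker ((residue ↥(closureValuationSubring (w.adicCompletion F))).comp (τR₁ τ)) ≠
          (((IsCMField.complexConj F) • w).asIdeal : Ideal (𝓞 F))) ↔
      σ₁.comp τ ∈ (flip ι₁ (bar Φ)).1 := by
  rw [mem_flip_bar_iff_of_signature Φ hι₁ M hM]
  refine and_congr_right fun hM0 => ⟨fun hker heq => hker ?_, fun hne hker => ?_⟩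
  · -- `σ₁ ∘ τ = ῑ₁` ⇒ `τ = τ_w ∘ c ↦ c•w`
    rw [eq_of_comp_eq_comp w σ₁ (heq.trans (comp_structural_comp_complexConj_eq w ι₁ σ₁ hσ₁).symm)]
    exact ker_residue_restrict_structural_comp_complexConj w τR₁ hτR₁
  · -- `τ ↦ c•w`, `σ₁ ∘ τ ≠ ῑ₁`: adaptedness gives `σ₁ ∘ τ ∈ Φ`, and `σ₁ ∘ τ ≠ ι₁` since `τ_w ↦ w ≠ c•w`; so `M (σ₁ ∘ τ) = 0`
    have hτne : τ ≠ ((algebraMap (w.adicCompletion F) (AlgebraicClosure (w.adicCompletion F))).comp (algebraMap F (w.adicCompletion F))).comp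
        ((IsCMField.complexConj F : F ≃ₐ[↥(maximalRealSubfield F)] F) : F →+* F) := by
      rintro rfl
      exact hne (comp_structural_comp_complexConj_eq w ι₁ σ₁ hσ₁)
    have hmem : σ₁.comp τ ∈ Φ.1 := hadapt τ hker hτne
    have hne₁ : σ₁.comp τ ≠ ι₁ := by
      intro h₁
      have hτ := eq_of_comp_eq_comp w σ₁ (h₁.trans hσ₁.symm)
      rw [hτ, ker_residue_restrict_structural w τR₁ hτR₁] at hker
      exact hw (HeightOneSpectrum.ext hker).symm
    rcases (hM _).mp hM0 with h | h | h
    · exact hne₁ h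
    · exact hne h
    · exact h hmem

include hτR₁ hσ₁ in
/-- **THE INDEX-SET IDENTITY** (Finset form of `signature_ne_zero_and_ker_ne_iff`): under the same hypotheses,
`univ.filter (M (σ₁ ∘ τ) ≠ 0 ∧ τ ∤ c•w) = univ.filter (σ₁ ∘ τ ∈ flip ι₁ (bar Φ))` — the (FROB-can) index set of `𝔞_can(M ∘ (σ₁ ∘ ·), τR₁, w)` is the `p`-adic
reading of the twist type. [cite: RapoportSmithlingZhang2020Diagonal, §4.1 (4.6) p. 16 and p. 17; §3.2 (3.8) p. 11] -/
theorem filter_signature_eq_filter_comp_mem_flip_bar (hw : (IsCMField.complexConj F) • w ≠ w) (Φ : CMType F) (hι₁ : ι₁ ∈ Φ.1)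
    (M : (F →+* ℂ) → ℕ) (hM : ∀ φ : F →+* ℂ, M φ ≠ 0 ↔ φ = ι₁ ∨ φ = ComplexEmbedding.conjugate ι₁ ∨ φ ∉ Φ.1)
    (hadapt : ∀ τ : F →+* AlgebraicClosure (w.adicCompletion F),
      RingHom.ker ((residue ↥(closureValuationSubring (w.adicCompletion F))).comp (τR₁ τ)) =
        ((IsCMField.complexConj F) • w).asIdeal →
      τ ≠ ((algebraMap (w.adicCompletion F) (AlgebraicClosure (w.adicCompletion F))).comp (algebraMap F (w.adicCompletion F))).comp
        ((IsCMField.complexConj F : F ≃ₐ[↥(maximalRealSubfield F)] F) : F →+* F) →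
      σ₁.comp τ ∈ Φ.1)
    [DecidablePred (· ∈ (flip ι₁ (bar Φ)).1)] :
    Finset.univ.filter (fun τ : F →+* AlgebraicClosure (w.adicCompletion F) =>
        M (σ₁.comp τ) ≠ 0 ∧
          RingHom.ker ((residue ↥(closureValuationSubring (w.adicCompletion F))).comp (τR₁ τ)) ≠
            (((IsCMField.complexConj F) • w).asIdeal : Ideal (𝓞 F))) =
      Finset.univ.filter (fun τ : F →+* AlgebraicClosure (w.adicCompletion F) => σ₁.comp τ ∈ (flip ι₁ (bar Φ)).1) :=
  Finset.filter_congr fun τ _ => signature_ne_zero_and_ker_ne_iff w τR₁ hτR₁ ι₁ σ₁ hσ₁ hw Φ hι₁ M hM hadapt τ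

include hτR₁ hσ₁ in
/-- **ADAPTEDNESS AT `(τR₁, σ₁)` FROM THE KOTTWITZ COUNT** (LA4-p05 (g4) 2026-09-02T07:46:38Z): if `∑_{τ ↦ c•w} M (σ₁ ∘ τ) = 1` (spine row `m_count`, ★ p847313
`sum_filter_ker_residue_restrict_eq_one`) for a signature of shape `hM`, then every `τ ↦ c•w` other than `τ_w ∘ c` has `σ₁ ∘ τ ∈ Φ`: `τ_w ∘ c ↦ c•w` already carries
`M (ῑ₁) ≠ 0`, so `M (σ₁ ∘ τ) = 0`, i.e. `σ₁ ∘ τ ∈ Φ` off the pair. [cite: RapoportSmithlingZhang2020Diagonal, §4.1 (4.6) p. 16 and p. 17] [cite: Kottwitz1992, §5 pp. 389–391] -/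
theorem comp_mem_of_sum_eq_one (Φ : CMType F)
    (M : (F →+* ℂ) → ℕ) (hM : ∀ φ : F →+* ℂ, M φ ≠ 0 ↔ φ = ι₁ ∨ φ = ComplexEmbedding.conjugate ι₁ ∨ φ ∉ Φ.1)
    (hcount : ∑ τ ∈ (Finset.univ.filter fun τ : F →+* AlgebraicClosure (w.adicCompletion F) =>
        RingHom.ker ((residue ↥(closureValuationSubring (w.adicCompletion F))).comp (τR₁ τ)) =
          (((IsCMField.complexConj F) • w).asIdeal : Ideal (𝓞 F))), M (σ₁.comp τ) = 1)
    (τ : F →+* AlgebraicClosure (w.adicCompletion F))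
    (hker : RingHom.ker ((residue ↥(closureValuationSubring (w.adicCompletion F))).comp (τR₁ τ)) =
      ((IsCMField.complexConj F) • w).asIdeal)
    (hne : τ ≠ ((algebraMap (w.adicCompletion F) (AlgebraicClosure (w.adicCompletion F))).comp (algebraMap F (w.adicCompletion F))).comp
      ((IsCMField.complexConj F : F ≃ₐ[↥(maximalRealSubfield F)] F) : F →+* F)) :
    σ₁.comp τ ∈ Φ.1 := by
  classical
  set τc : F →+* AlgebraicClosure (w.adicCompletion F) :=
    ((algebraMap (w.adicCompletion F) (AlgebraicClosure (w.adicCompletion F))).comp (algebraMap F (w.adicCompletion F))).comp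
      ((IsCMField.complexConj F : F ≃ₐ[↥(maximalRealSubfield F)] F) : F →+* F) with hτc
  have hsub : ({τ, τc} : Finset (F →+* AlgebraicClosure (w.adicCompletion F))) ⊆
      Finset.univ.filter fun τ : F →+* AlgebraicClosure (w.adicCompletion F) =>
        RingHom.ker ((residue ↥(closureValuationSubring (w.adicCompletion F))).comp (τR₁ τ)) =
          (((IsCMField.complexConj F) • w).asIdeal : Ideal (𝓞 F)) := by
    intro x hx
    rw [Finset.mem_filter]
    refine ⟨Finset.mem_univ _, ?_⟩
    rcases Finset.mem_insert.mp hx with rfl | hx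
    · exact hker
    · rw [Finset.mem_singleton.mp hx, hτc]
      exact ker_residue_restrict_structural_comp_complexConj w τR₁ hτR₁
  have hle := Finset.sum_le_sum_of_subset (f := fun τ : F →+* AlgebraicClosure (w.adicCompletion F) => M (σ₁.comp τ)) hsub
  rw [Finset.sum_pair hne, hcount] at hle
  have hc0 : M (σ₁.comp τc) ≠ 0 :=
    (hM _).mpr (Or.inr (Or.inl (by rw [hτc]; exact comp_structural_comp_complexConj_eq w ι₁ σ₁ hσ₁)))
  have hM0 : M (σ₁.comp τ) = 0 := by
    have : M (σ₁.comp τ) + M (σ₁.comp τc) ≤ 1 := hle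
    omega
  by_contra hnot
  exact ((hM _).mpr (Or.inr (Or.inr hnot))) hM0

end Place

/-! ### §2 The embedding product over a type read through `ι₁` is its reflex type norm of `𝔭_w`, READ ON `F` -/

section OnF

variable [NumberField F] [IsGalois ℚ F] (w : HeightOneSpectrum (𝓞 F))
  (τR₁ : (F →+* AlgebraicClosure (w.adicCompletion F)) → (𝓞 F →+* ↥(closureValuationSubring (w.adicCompletion F))))
  (hτR₁ : ∀ (τ : F →+* AlgebraicClosure (w.adicCompletion F)) (x : 𝓞 F),
    ((τR₁ τ x : ↥(closureValuationSubring (w.adicCompletion F))) : AlgebraicClosure (w.adicCompletion F)) = τ (x : F))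
  (ι₁ : F →+* ℂ) (σ₁ : AlgebraicClosure (w.adicCompletion F) →+* ℂ)
  (hσ₁ : σ₁.comp ((algebraMap (w.adicCompletion F) (AlgebraicClosure (w.adicCompletion F))).comp (algebraMap F (w.adicCompletion F))) = ι₁)

include hτR₁ hσ₁ in
/-- **`∏_{τ : σ₁ ∘ τ ∈ Ψ} ker (residue ∘ τR₁ τ) = g_F(𝔭_w)` for the type `valuedIn ι₁ Ψ ⊆ Hom(F, F)`** (ANY `Ψ ⊆ Hom(F, ℂ)`, `F ∕ ℚ` Galois, `σ₁` over `ι₁`): ★ p849648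
§2 `prod_filter_ker_eq_idealReflexTypeNorm` at the admissible presentation `(Lg, ι, j, σ₀) := (F, ι₁, id, id)`, whose type `{φ : F → F | ι₁ ∘ φ ∈ Ψ}` IS ★ `valuedIn ι₁ Ψ`.
So the reflex type norm is READ ON `F`: no reflex compositum, no ring-equivalence transport (cf. ★ p850247).
[cite: Shimura1998, §13.1 (1), (7) and Theorem 1 (pp. 97–99); §18.6 proof pp. 127–128] [cite: MilneCM2006, Ch. I §1 Prop. 1.26 (11)] -/
theorem prod_filter_ker_eq_idealReflexTypeNorm_valuedIn (Ψ : Set (F →+* ℂ)) [DecidablePred (· ∈ Ψ)] :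
    ∏ τ ∈ Finset.univ.filter (fun τ : F →+* AlgebraicClosure (w.adicCompletion F) => σ₁.comp τ ∈ Ψ),
        RingHom.ker ((residue ↥(closureValuationSubring (w.adicCompletion F))).comp (τR₁ τ)) =
      idealReflexTypeNorm (valuedIn ι₁ Ψ) (RingHom.id F) (RingHom.id F) w.asIdeal :=
  prod_filter_ker_eq_idealReflexTypeNorm w τR₁ hτR₁ Ψ σ₁ ι₁ (RingHom.id F) (RingHom.id F)
    (by rw [RingHom.comp_id, ← hσ₁, ← IsScalarTower.algebraMap_eq])

/-! ### §3 HEADS — (S7-F): the reflex type norm of `𝔭_w` for the twist type, read on `F`, IS the canonical twist ideal -/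

variable [IsCMField F]

include hτR₁ hσ₁ in
/-- **(S7-F) HEAD — `g_F(𝔭_w)` FOR THE TWIST TYPE `flip ι₁ (bar Φ)` READ THROUGH `ι₁` IS `𝔞_can(M ∘ (σ₁ ∘ ·), τR₁, w)`**, at a split place `w`, for a frame `Φ ∋ ι₁`
ADAPTED to `w` at `(τR₁, σ₁)` and a signature `M` of the `mOf ι₁ Φ` shape `hM`:
`idealReflexTypeNorm (valuedIn ι₁ (flip ι₁ (bar Φ)).1) id id 𝔭_w = ∏ τ ∈ univ.filter (M (σ₁ ∘ τ) ≠ 0 ∧ τ ∤ c•w), ker (residue ∘ τR₁ τ)` (§2 + §1).  RIGHT side = the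
(FROB-can) ∕ ★ p849355 HEAD-σ token of the Shimura–Taniyama datum LITERALLY; LEFT side = the `hcan` input of p850297 `exists_sheetTwist_frobenius` at `Φ′ := twistType ι₁ Φ hΦ`.
[cite: Shimura1998, §13.1 Theorem 1 (pp. 97–99) and (7); §18.6 proof pp. 127–128] [cite: MilneCM2006, Ch. I §1 Prop. 1.26 (11)] [cite: RapoportSmithlingZhang2020Diagonal, §4.1 (4.6) p. 16 and p. 17; §3.2 (3.8) p. 11] -/
theorem idealReflexTypeNorm_valuedIn_flip_bar_eq_prod_filter (hw : (IsCMField.complexConj F) • w ≠ w) (Φ : CMType F) (hι₁ : ι₁ ∈ Φ.1)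
    (M : (F →+* ℂ) → ℕ) (hM : ∀ φ : F →+* ℂ, M φ ≠ 0 ↔ φ = ι₁ ∨ φ = ComplexEmbedding.conjugate ι₁ ∨ φ ∉ Φ.1)
    (hadapt : ∀ τ : F →+* AlgebraicClosure (w.adicCompletion F),
      RingHom.ker ((residue ↥(closureValuationSubring (w.adicCompletion F))).comp (τR₁ τ)) =
        ((IsCMField.complexConj F) • w).asIdeal →
      τ ≠ ((algebraMap (w.adicCompletion F) (AlgebraicClosure (w.adicCompletion F))).comp (algebraMap F (w.adicCompletion F))).comp
        ((IsCMField.complexConj F : F ≃ₐ[↥(maximalRealSubfield F)] F) : F →+* F) →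
      σ₁.comp τ ∈ Φ.1) :
    idealReflexTypeNorm (valuedIn ι₁ (flip ι₁ (bar Φ)).1) (RingHom.id F) (RingHom.id F) w.asIdeal =
      ∏ τ ∈ Finset.univ.filter (fun τ : F →+* AlgebraicClosure (w.adicCompletion F) =>
          M (σ₁.comp τ) ≠ 0 ∧ RingHom.ker ((residue ↥(closureValuationSubring (w.adicCompletion F))).comp (τR₁ τ)) ≠
            (((IsCMField.complexConj F) • w).asIdeal : Ideal (𝓞 F))),
        RingHom.ker ((residue ↥(closureValuationSubring (w.adicCompletion F))).comp (τR₁ τ)) := by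
  classical
  rw [← prod_filter_ker_eq_idealReflexTypeNorm_valuedIn w τR₁ hτR₁ ι₁ σ₁ hσ₁ (flip ι₁ (bar Φ)).1]
  exact Finset.prod_congr (filter_signature_eq_filter_comp_mem_flip_bar w τR₁ hτR₁ ι₁ σ₁ hσ₁ hw Φ hι₁ M hM hadapt).symm fun _ _ => rfl

include hτR₁ hσ₁ in
/-- **(S7-F) HEAD FROM THE COUNT**: the same identity with adaptedness replaced by the Kottwitz count `∑_{τ ↦ c•w} M (σ₁ ∘ τ) = 1` (the row `hcount` the (S6) zip ★
`exists_twistData_letterRows_of_kottRows` already takes). [cite: Shimura1998, §13.1 Theorem 1 (pp. 97–99) and (7)] [cite: RapoportSmithlingZhang2020Diagonal, §4.1 (4.6) p. 16 and p. 17] -/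
theorem idealReflexTypeNorm_valuedIn_flip_bar_eq_prod_filter_of_sum_eq_one (hw : (IsCMField.complexConj F) • w ≠ w) (Φ : CMType F) (hι₁ : ι₁ ∈ Φ.1)
    (M : (F →+* ℂ) → ℕ) (hM : ∀ φ : F →+* ℂ, M φ ≠ 0 ↔ φ = ι₁ ∨ φ = ComplexEmbedding.conjugate ι₁ ∨ φ ∉ Φ.1)
    (hcount : ∑ τ ∈ (Finset.univ.filter fun τ : F →+* AlgebraicClosure (w.adicCompletion F) =>
        RingHom.ker ((residue ↥(closureValuationSubring (w.adicCompletion F))).comp (τR₁ τ)) =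
          (((IsCMField.complexConj F) • w).asIdeal : Ideal (𝓞 F))), M (σ₁.comp τ) = 1) :
    idealReflexTypeNorm (valuedIn ι₁ (flip ι₁ (bar Φ)).1) (RingHom.id F) (RingHom.id F) w.asIdeal =
      ∏ τ ∈ Finset.univ.filter (fun τ : F →+* AlgebraicClosure (w.adicCompletion F) =>
          M (σ₁.comp τ) ≠ 0 ∧ RingHom.ker ((residue ↥(closureValuationSubring (w.adicCompletion F))).comp (τR₁ τ)) ≠
            (((IsCMField.complexConj F) • w).asIdeal : Ideal (𝓞 F))),
        RingHom.ker ((residue ↥(closureValuationSubring (w.adicCompletion F))).comp (τR₁ τ)) :=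
  idealReflexTypeNorm_valuedIn_flip_bar_eq_prod_filter w τR₁ hτR₁ ι₁ σ₁ hσ₁ hw Φ hι₁ M hM
    (comp_mem_of_sum_eq_one w τR₁ hτR₁ ι₁ σ₁ hσ₁ Φ M hM hcount)

include hτR₁ hσ₁ in
/-- **(S7-F) HEAD IN THE `KottAdaptedAt` SHAPE (the `s7F_pin` signature of the `stub_TWIST` assembly)**: hypothesis `hΦw` = the body of the Lines token
`KottAdaptedAt ι₁ w Φ` VERBATIM (for every restriction family `τR` with `τR_spec`, every `σ : F̄_w → ℂ` over `ι₁` and every `τ ↦ c•w` other than `τ_w ∘ c`,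
`σ ∘ τ ∈ Φ`), specialised inside to `(τR₁, σ₁)`.  At the call site: `s7F_pin ι₁ Φ hΦ w hw σ₁ hσ₁ τR₁ hτR₁ had := idealReflexTypeNorm_valuedIn_flip_bar_eq_prod_filter_of_kottAdaptedAt
w τR₁ hτR₁ ι₁ σ₁ hσ₁ hw ⟨Φ, hΦ.2⟩ hΦ.1 (mOf ι₁ Φ) (mOf_ne_zero_iff ι₁ Φ) had` (`twistType ι₁ Φ hΦ = flip ι₁ (bar ⟨Φ, hΦ.2⟩)` by `rfl`).
[cite: Shimura1998, §13.1 Theorem 1 (pp. 97–99) and (7); §18.6 proof pp. 127–128] [cite: RapoportSmithlingZhang2020Diagonal, §4.1 (4.6) p. 16 and p. 17; §3.2 (3.8) p. 11] -/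
theorem idealReflexTypeNorm_valuedIn_flip_bar_eq_prod_filter_of_kottAdaptedAt (hw : (IsCMField.complexConj F) • w ≠ w) (Φ : CMType F)
    (hι₁ : ι₁ ∈ Φ.1) (M : (F →+* ℂ) → ℕ) (hM : ∀ φ : F →+* ℂ, M φ ≠ 0 ↔ φ = ι₁ ∨ φ = ComplexEmbedding.conjugate ι₁ ∨ φ ∉ Φ.1)
    (hΦw : ∀ (τR : (F →+* AlgebraicClosure (w.adicCompletion F)) → (𝓞 F →+* ↥(closureValuationSubring (w.adicCompletion F)))),
      (∀ (τ : F →+* AlgebraicClosure (w.adicCompletion F)) (x : 𝓞 F),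
        ((τR τ x : ↥(closureValuationSubring (w.adicCompletion F))) : AlgebraicClosure (w.adicCompletion F)) = τ (x : F)) →
      ∀ (σ : AlgebraicClosure (w.adicCompletion F) →+* ℂ),
        σ.comp ((algebraMap (w.adicCompletion F) (AlgebraicClosure (w.adicCompletion F))).comp (algebraMap F (w.adicCompletion F))) = ι₁ →
        ∀ τ : F →+* AlgebraicClosure (w.adicCompletion F),
          RingHom.ker ((IsLocalRing.residue ↥(closureValuationSubring (w.adicCompletion F))).comp (τR τ)) =
            ((IsCMField.complexConj F) • w).asIdeal →
          τ ≠ ((algebraMap (w.adicCompletion F) (AlgebraicClosure (w.adicCompletion F))).comp (algebraMap F (w.adicCompletion F))).comp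
            ((IsCMField.complexConj F : F ≃ₐ[↥(maximalRealSubfield F)] F) : F →+* F) →
          σ.comp τ ∈ Φ.1) :
    idealReflexTypeNorm (valuedIn ι₁ (flip ι₁ (bar Φ)).1) (RingHom.id F) (RingHom.id F) w.asIdeal =
      ∏ τ ∈ Finset.univ.filter (fun τ : F →+* AlgebraicClosure (w.adicCompletion F) =>
          M (σ₁.comp τ) ≠ 0 ∧ RingHom.ker ((residue ↥(closureValuationSubring (w.adicCompletion F))).comp (τR₁ τ)) ≠
            (((IsCMField.complexConj F) • w).asIdeal : Ideal (𝓞 F))),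
        RingHom.ker ((residue ↥(closureValuationSubring (w.adicCompletion F))).comp (τR₁ τ)) :=
  idealReflexTypeNorm_valuedIn_flip_bar_eq_prod_filter w τR₁ hτR₁ ι₁ σ₁ hσ₁ hw Φ hι₁ M hM (hΦw τR₁ hτR₁ σ₁ hσ₁)

end OnF

end Summit.HodgeConjecture.HodgeConjecture.Theorems.F0P6aTwistTypeFrobeniusPin

end
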